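import Literature.MathematicalPhysics.QuantumFieldTheory.Balaban1983to89.B6QGGQCoerciveMultiLevelTorusL0
import Literature.MathematicalPhysics.QuantumFieldTheory.Balaban1983to89.B6Ineq268MultiLevelTorusL0
import Literature.MathematicalPhysics.QuantumFieldTheory.Balaban1983to89.B6Ineq281MultiLevelBoxL0
import Literature.MathematicalPhysics.QuantumFieldTheory.Balaban1983to89.B6Geom246MultiLevelBoxL0
import Literature.MathematicalPhysics.QuantumFieldTheory.Balaban1983to89.B6Geom246MultiLevelTorusL0
import Literature.MathematicalPhysics.QuantumFieldTheory.Balaban1983to89.B6Ineq268MultiLevelBoxL0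
import Literature.MathematicalPhysics.QuantumFieldTheory.Balaban1983to89.B6MultiLevelBoxOperatorL0
import Literature.MathematicalPhysics.QuantumFieldTheory.Balaban1983to89.B6MultiLevelTorusOperatorL0
import Literature.MathematicalPhysics.QuantumFieldTheory.Balaban1983to89.B6QGQCoerciveMultiLevelBoxL0
import Literature.MathematicalPhysics.QuantumFieldTheory.Balaban1983to89.B8Ineq192MultiLevelTorusL0
/-!
# `Balaban1983to89.B6Prop23MultiLevelTorusL0` — LEVEL-0 TWIN (programme G-F3′-L0, director-ym LINE №27 / UV3-NODE §24.5; plan `lit-balaban-r03/G-F3L0-PLAN.md`) of `B6Prop23MultiLevelTorus`: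
the same declarations, SAME NAMES AND STATEMENTS, for nested families WITH print's region `Λ₀ = T ∖ Ω₁` ADMITTED (structures
`B6MultiLevelBoxOperatorL0.Domains` / `B6MultiLevelTorusOperatorL0.TDomains`: levels `0, …, k`, the level-`0` block a single site, `Q′₀ = id`,
finite weight `a₀` — print p.225 (2.14) «Σ_{j=0}^k … (Q′₀λ)(x) = λ(x), x ∈ Λ₀», p.229 «taking a sequence (2.1) … smallest possible domains B^j(Λ_j),
and considering the operator Δ_a defined by (2.19), (2.20) for this sequence»).  Every `D`-free object is the lineage's, consumed BY NAME; no existing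
module is touched; no fact is minted.  Unit `lit-balaban-r03` (B6 fold owner, r03 gen 36); referee ref-4.  THE TWIN'S DOCUMENTATION FOLLOWS
VERBATIM (its «levels 1 … k» / «Ω₁ = X» sentences describe the twin; here `j` runs from `0` and `Ω₁` may be a proper subset).

# `Balaban1983to89.B6Prop23MultiLevelTorus` — [B6] PROPOSITION 2.3, THE ESTIMATE (2.87), FOR THE GENUINE `k`-LEVEL
OPERATOR `G′ = Δ′_a⁻¹` ON THE TORUS `T_η`: the inverse `(Q′G′²Q′*)⁻¹` of an ARBITRARY nested family (2.1)–(2.2) on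
print's carrier exists, is unique, and its (2.69)-kernel obeys `|(Q′G′²Q′*)⁻¹(y, y′)| ≤ O(1)(L^jη)^{−4}(L^{j′}η)^{−d}
e^{−½δ₁d_T(y,y′)}` — by «the theory developed in Sect. 5 [3]» applied to the WHOLE block lattice `𝔅` of the torus
(file 3 of the torus `(Q′G′²Q′*)⁻¹` programme of seat p21; no existing module is touched; no fact is minted)

FRAMING (verbatim cell line):
statement-level skeleton of published theorems with citation tags; proofs where landed; nothing here is a claim about the Yang–Mills mass gap

Source under audit (cell pub-balaban / lit-balaban): T. Bałaban, *Propagators and renormalization transformations for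
lattice gauge theories. II*, Commun. Math. Phys. **96** (1984) 223–250 [`Balaban1984PropagatorsII`, "B6"], pp. 235–238
[PDF 13–16] (2.68)–(2.87) (held text `paper:balaban1984-cmp96-propagators-rt-ii` p0013–p0016, re-read this generation);
T. Bałaban, *Regularity and decay of lattice Green's functions*, Commun. Math. Phys. **89** (1983) 571–597
[`Balaban1983RegularityDecay`, "[3]"], Sect. 5 (5.6)–(5.7) p. 594.  Unit `lit-balaban-p21` (Phase-2 proof seat p21
gen 16), HOME `run/shared/lean/pub/lit-balaban/`, free-target protocol G.5-34(d) (B6-CLOSURE item 7 (d2) of the fold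
owner r03), referee ref-4.

## WHAT IS PRINTED (pp. 235, 237, 238, verbatim up to notation)

p. 235: «Now we will consider the operator (Q′G′²Q′*)⁻¹. Of course the operator Q′G′²Q′* is positive definite, so its
inverse is well defined. We will construct it and investigate its properties using again a random walk expansion. Our
considerations are analogous to Sect. 5 of [3], concerning unit lattice operators.»  p. 237: «Of course we have also a
bound from above and an exponential decay of the kernel of Q′G′^ξ(□̃)²Q′* with the decay rate δ₀. Hence the operator C^ξ_□
is bounded from above and below by absolute constants. We can use the theory developed in Sect. 5 [3] to conclude that it
has an exponential decay with a decay rate δ₁ depending on δ₀ and the bound γ₀. … From (2.71) we obtain the following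
scaling law for the operators C_□: C_□(y, y′) = (L^jη)^{−d−4}C^ξ_□((L^jη)^{−1}y, (L^jη)^{−1}y′), (2.80)»  p. 238:
«**Proposition 2.3.** An inverse of the operator Q′G′²Q′* is given by the convergent expansion (Q′G′²Q′*)⁻¹ = C(I − R)⁻¹ =
Σ_{n=0}^∞ CRⁿ = …, (2.86) and it satisfies the estimate |(Q′G′²Q′*)⁻¹(y, y′)| ≤ O(1)(L^jη)^{−4}(L^{j′}η)^{−d}e^{−½δ₁d(y,y′)},
y, y′ ∈ 𝔅, y ∈ Λ_j, y′ ∈ Λ_{j′}. (2.87)»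

## WHAT THIS FILE CERTIFIES (kernel-checked; setting of `B6MultiLevelTorusOperator` / `B8Ineq192MultiLevelTorus`)

For every nested family `D : TDomains d ℓ M_h k P R` on the torus (levels `1 … k`, `Ω₁ = T_η`, lattice units, spatial
dimension `d + 1`, `L ≥ 2`), windowed weights, the genuine `k`-level torus `G′ = gmlT` and the (2.69)-kernel `X = XkT` of
`Q′G′²Q′*` (r05's `B8Ineq192MultiLevelTorus`, used BY NAME):
* §1 `⟨f, Q′G′²Q′*g⟩_{(2.69)} = ⟨G′Q′*f, G′Q′*g⟩` on the torus (`wform_XkT`, the identity behind (2.72)) and the symmetry of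
  `X` (`XkT_symm`);
* §2 the conjugated kernel `B = Λ⁻²W^{½}·X·W^{½}Λ⁻²` (`BmT`; `Λ = diag(L^j)`, `W = diag((L^j)^{d+1})`): symmetric, its
  Euclidean form is `‖G′Q′*g‖²` (`BmT_form`), hence **coercive with `γ_B = C₄⁻¹` ON ALL OF `𝔅`** (the GLOBAL (2.78) of
  file 2 `B6QGGQCoerciveMultiLevelTorusL0.qggq_coercive_multiLevelTorus`; `BmT_coercive`), with entries
  `|B(y, y′)| ≤ C·L^{d+3}·e^{−(δ₀/8)d_T(y,y′)}` ((2.68)_T of file 1 plus the torus (2.60) `levelSepTB`: the level ratios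
  `L^{(d+3)|j−j′|}` are absorbed by `e^{−(δ₀/8)d_T}` under `L^{d+3} ≤ e^{(δ₀/8)(RM−1)}`; `BmT_entry_le`);
* §3 [3] Sect. 5 (5.6) ⇒ (5.7) for `B` on the WHOLE of `𝔅` (`B4Sect5Torus.inv_decay` over the pseudo-distance `d_T` —
  `isPseudoDist_distT` from `triangle_refl_nonneg_T` — with the (2.61) profile of the torus `sumBound_torus` from
  `lemma21_torus` at `α = 1/16`): `|B⁻¹(y, y′)| ≤ 2C₄e^{−δ₁d_T(y,y′)}`, `δ₁ = rate(profile, C₄⁻¹, CL^{d+3}, δ₀/8)`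
  (`invBmT_decay`) — print's «the theory developed in Sect. 5 [3]» with «the bound γ₀» = `C₄⁻¹`;
* §4 **THE INVERSE** `(Q′G′²Q′*)⁻¹ = GinvT = kerOp W CinvT`, `CinvT = Λ⁻²W^{−½}B⁻¹W^{½}Λ⁻²/W` (the conjugation undone,
  (2.80)): `Q′G′²Q′*·GinvT = 1 = GinvT·Q′G′²Q′*` (`X_mul_GinvT`, `GinvT_mul_X`), uniqueness (`GinvT_unique`), and the kernel
  bound in print's asymmetric shape `|C(y, y′)| ≤ 2C₄L^{d+3}(L^j)^{−4}W(y′)⁻¹e^{−½δ₁d_T}` (`CinvT_decay`: the symmetric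
  weights `(L^j)^{−2}W(y)^{−½}(L^{j′})^{−2}W(y′)^{−½}` versus print's `(L^j)^{−4}W(y′)^{−1}` cost `L^{(d+3)|j−j′|}`, absorbed by
  `e^{−½δ₁d_T}` through (2.60) under `L^{d+3} ≤ e^{½δ₁(RM−1)}` — print: «The choice of factors is again arbitrary»);
* §5 **`prop23_multiLevelTorus`** — PROPOSITION 2.3 (2.87) on `T_η`, thresholds explicit: `∃ δ₁, C, M₀ > 0` (functions
  of `d, L`, the weight window) `∀ k, M_h` with `L·M_h ≥ M₀`, `R ≥ 2L`, `P_μ ≥ 4`, `∀ D`, weights: the two inverse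
  identities, uniqueness, and `|mat GinvT y y′/W(y′)| ≤ C(L^j)^{−4}(L^{j′})^{−(d+1)}e^{−½δ₁d_T(y,y′)}` — the shape of the
  Neumann-box twin `B6Prop23MultiLevelBox.prop23_multiLevelBox` and of the consumer slot of r05's
  `B8Ineq192MultiLevelTorusL0.ineq192_multiLevelTorus` (`∀ G, … |mat G y y′/W y′| ≤ C₁·len^{−4}·len′^{−(d+1)}·e^{−δ₁/2·d_T}`).

## HONEST SCOPE

* ROUTE. Print constructs `(Q′G′²Q′*)⁻¹` by the cube-wise approximate inverse `C = Σ_□h_□C_□h_□` (2.70) and the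
  expansion `C(I − R)⁻¹` (2.82)–(2.86), applying «the theory developed in Sect. 5 [3]» to each cube operator `C_□`
  ((2.79)); the Neumann-box twin `B6Prop23MultiLevelBox` certifies exactly that route.  THIS FILE applies the same
  [3] Sect. 5 theory ((5.6) ⇒ (5.7), kernel-checked as `B4Sect5Torus.inv_decay`) ONCE, to `Q′G′²Q′*` on the whole block
  lattice `𝔅` of the torus, which is possible because file 2 proves the lower bound (2.78) GLOBALLY (not only on
  two-level windows).  Consequently the ESTIMATE (2.87) and the existence/uniqueness of the inverse are certified on
  `T_η`, while the EXPANSION (2.86) `= C(I − R)⁻¹ = Σ CRⁿ` is NOT re-derived on `T_η` here (it needs the torus cover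
  `{h_□}` with (2.46)-Lipschitz bounds; it stays certified on the Neumann box).  The census typing `B6.Prop23Printed`
  (= (2.87)) and the consumers of Prop. 2.3 in the tree ((2.88), [B8] (1.91)–(1.101)) use (2.87) only.
* Print's carrier `T_η` with `Ω₁ = T_η` (levels `1 … k`), `A = 0`, `m² = 0`, lattice units (`(L^jη)^{−4}(L^{j′}η)^{−d}`
  ↦ `(L^j)^{−4}(L^{j′})^{−(d+1)}`, spatial dimension `d + 1`), `P_μ ≥ 4` (the charts of (2.67)₁ on `T_η`), `R ≥ 2L`;
  all thresholds folded into ONE condition `L·M_h ≥ M₀` (using `R ≥ 2L ≥ 1`); constants explicit (`C = 2C₄L^{d+3}`,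
  `δ₁` the [3] Sect. 5 rate), `k`-uniform, not optimised.
* Nothing is inferred from the manuscript: every step is kernel-checked; the quoted sentences locate the statements.
-/

namespace Literature.MathematicalPhysics.QuantumFieldTheory.Balaban1983to89.B6Prop23MultiLevelTorusL0

open Finset Matrix
open Literature.MathematicalPhysics.QuantumFieldTheory.Balaban1983to89.B4Reflection242 (boxDom)
open Literature.MathematicalPhysics.QuantumFieldTheory.Balaban1983to89.B6MultiLevelBoxOperator hiding Domains mlOp_apply
open Literature.MathematicalPhysics.QuantumFieldTheory.Balaban1983to89.B6MultiLevelBoxOperatorL0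
open Literature.MathematicalPhysics.QuantumFieldTheory.Balaban1983to89.B6MultiLevelTorusOperator (gmlT gmlT_isSymm)
open Literature.MathematicalPhysics.QuantumFieldTheory.Balaban1983to89.B6MultiLevelTorusOperatorL0 (TDomains)
open Literature.MathematicalPhysics.QuantumFieldTheory.Balaban1983to89.B6Geom246MultiLevelBox hiding Touch blkOf blkOf_corner blkOf_eq_iff_blk blkOf_eq_of_blk_i_eq blkOf_val bond bond_adj bset cen connected coord_bounds corner corner_mem csys dist_blkOf_le_box dist_blkOf_le_coord dist_blkOf_le_line dist_cen_le_of_adj dist_cen_le_of_touch dist_le_one_of_near dist_toR_cen_le exists_blkOf_eq geom lemma21_box lev_corner lev_eq_of_blkOf_eq levelGap pack reachable_blkOf reachable_of_near realizes scale_bounds touch_symm triangle_refl_nonneg walk_disp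
open Literature.MathematicalPhysics.QuantumFieldTheory.Balaban1983to89.B6Geom246MultiLevelBoxL0
open Literature.MathematicalPhysics.QuantumFieldTheory.Balaban1983to89.B6Geom246MultiLevelTorus hiding TouchT blkHom blkMap blkMap_blkOf blkMap_injective blkMap_surjective blkOf_tshift_eq bondT bondT_adj bond_le_bondT connectedT csysT distT_le_dist_box distT_le_dist_chart dist_posT_le_of_adj dist_posT_le_of_touchT dist_site_posT_le geomT label_bounds lemma21_torus levelGapT packT posT realizesT touchT_symm triangle_refl_nonneg_T walk_dispT
open Literature.MathematicalPhysics.QuantumFieldTheory.Balaban1983to89.B6Geom246MultiLevelTorusL0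
open Literature.MathematicalPhysics.QuantumFieldTheory.Balaban1983to89.B6Ineq268MultiLevelBoxL0 (W W_pos W_eq qB QB QsB QsB_apply)
open Literature.MathematicalPhysics.QuantumFieldTheory.Balaban1983to89.B8Ineq192MultiLevelTorusL0 (geomTB geomTB_dist geomTB_len geomT_len geomTB_L geomTB_eta geomTB_M geomTB_R geomTB_RM geomTB_RM_nonneg triangleTB symmTB symmT levelSepTB XkT kerOp_XkT lenT_pos lenT_eq)
open Literature.MathematicalPhysics.QuantumFieldTheory.Balaban1983to89.B6QGQCoerciveMultiLevelBoxL0 (nb one_le_nb nb_cast W_eq_nb_pow QsB_dot_QsB)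
open Literature.MathematicalPhysics.QuantumFieldTheory.Balaban1983to89.B6QGGQCoerciveMultiLevelTorus (C4 C4_pos)
open Literature.MathematicalPhysics.QuantumFieldTheory.Balaban1983to89.B6QGGQCoerciveMultiLevelTorusL0 (qggq_coercive_multiLevelTorus)
open Literature.MathematicalPhysics.QuantumFieldTheory.Balaban1983to89.B6Ineq268MultiLevelTorusL0 (ineq268_multiLevelTorus)
open Literature.MathematicalPhysics.QuantumFieldTheory.Balaban1983to89.B6Ineq281MultiLevelBox (Kprof rate_Kprof)
open Literature.MathematicalPhysics.QuantumFieldTheory.Balaban1983to89.B6Ineq281MultiLevelBoxL0 (mW cw lgap sum_W_mul_qB)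
open Literature.MathematicalPhysics.QuantumFieldTheory.Balaban1983to89.B6Ineq2142 (avgOp avgAdj kernelW avgOp_apply)
open Literature.MathematicalPhysics.QuantumFieldTheory.Balaban1983to89.B6Ineq243TwoLevelBox (aNext)
open Literature.MathematicalPhysics.QuantumFieldTheory.Balaban1983to89.B6Expansion282 (kerOp mulOp kerOp_apply)
open Literature.MathematicalPhysics.QuantumFieldTheory.Balaban1983to89.B6Prop23Chain (mat mat_kerOp)
open Literature.MathematicalPhysics.QuantumFieldTheory.Balaban1983to89.B4Sect5Torus (IsPseudoDist SumBound Hyp56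
  rate inv_decay isUnit_of_hyp56 rate_pos)
open Literature.MathematicalPhysics.QuantumFieldTheory.Balaban1983to89.B6Ineq261LevelGap (K261 K261_nonneg
  theta_lt_one_of_log)
open Literature.MathematicalPhysics.QuantumFieldTheory.Balaban1983to89.B6Lemma21Repaired (Ineq261With)
open Literature.MathematicalPhysics.QuantumFieldTheory.Balaban1983to89.B6Ineq268 (LevelSep mx)

noncomputable section

variable {d : ℕ}

/-! ## §1 The `(2.69)`-form of `Q′G′²Q′*` on the torus and the symmetry of its kernel -/

section Form

variable {ℓ Mh k R : ℕ} {P : Fin (d + 1) → ℕ} (D : TDomains d ℓ Mh k P R) (a : ℕ → ℝ)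

/-- shorthand: the genuine `k`-level torus `G′` as a matrix. [cite: Balaban1984PropagatorsII, p.225 («G′ = Δ′_a^{−1}»), p.224 (Ω₁ = T_η)] -/
abbrev GmT : Matrix ↥(boxDom (N0 ℓ Mh k P)) ↥(boxDom (N0 ℓ Mh k P)) ℝ := gmlT (N0 ℓ Mh k P) ℓ k D.lev a

/-- **`⟨f, Q′G′²Q′*g⟩_{(2.69)} = ⟨G′Q′*f, G′Q′*g⟩` ON THE TORUS** — the identity behind (2.72) «= ‖G′Q′*ω‖²» (symmetry
of `G′`, adjointness of `Q′`, `Q′*`). [cite: Balaban1984PropagatorsII, (2.72) p.236, (2.69) p.235] -/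
theorem wform_XkT (f g : ↥(bset D.toDomains) → ℝ) :
    ∑ y, W D.toDomains y * f y * (kerOp (W D.toDomains) (XkT D a) g) y =
      (GmT D a *ᵥ QsB D.toDomains f) ⬝ᵥ (GmT D a *ᵥ QsB D.toDomains g) := by
  rw [kerOp_XkT]
  simp only [LinearMap.comp_apply, Matrix.toLin'_apply]
  set u : ↥(boxDom (N0 ℓ Mh k P)) → ℝ := GmT D a *ᵥ (GmT D a *ᵥ QsB D.toDomains g) with hu
  have h1 : ∑ y, W D.toDomains y * f y * (QB D.toDomains) u y = ∑ x, f (blkOf D.toDomains x) * u x := by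
    unfold QB
    simp only [avgOp_apply, Finset.mul_sum]
    rw [Finset.sum_comm]
    refine Finset.sum_congr rfl fun x _ => ?_
    rw [← sum_W_mul_qB D.toDomains f x, Finset.sum_mul]
    exact Finset.sum_congr rfl fun y _ => by ring
  rw [h1]
  have h2 : ∑ x, f (blkOf D.toDomains x) * u x = QsB D.toDomains f ⬝ᵥ u := by
    unfold dotProduct; exact Finset.sum_congr rfl fun x _ => by rw [QsB_apply]
  rw [h2, hu, Matrix.dotProduct_mulVec, ← Matrix.mulVec_transpose,
    (gmlT_isSymm (N := N0 ℓ Mh k P) (ℓ := ℓ) (k := k) (lev := D.lev) (a := a)).eq]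

/-- **the torus kernel `X` of `Q′G′²Q′*` is symmetric**. [cite: Balaban1984PropagatorsII, (2.69) p.235, (2.72) p.236] -/
theorem XkT_symm (y y' : ↥(B6Geom246MultiLevelBoxL0.bset D.toDomains)) : XkT D a y y' = XkT D a y' y := by
  classical
  have key : ∀ u v : ↥(bset D.toDomains), W D.toDomains u * W D.toDomains v * XkT D a u v =
      (GmT D a *ᵥ QsB D.toDomains (Pi.single u 1)) ⬝ᵥ (GmT D a *ᵥ QsB D.toDomains (Pi.single v 1)) := by
    intro u v
    rw [← wform_XkT D a (Pi.single u 1) (Pi.single v 1)]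
    rw [Finset.sum_eq_single u]
    · rw [Pi.single_eq_same, mul_one]
      have hX : (kerOp (W D.toDomains) (XkT D a)) (Pi.single v 1) u = mat (kerOp (W D.toDomains) (XkT D a)) u v := rfl
      rw [hX, mat_kerOp]; ring
    · intro b _ hb; rw [Pi.single_eq_of_ne hb]; ring
    · intro h; exact absurd (Finset.mem_univ u) h
  have h := key y y'
  rw [dotProduct_comm, ← key y' y] at h
  have hW : W D.toDomains y * W D.toDomains y' ≠ 0 := mul_ne_zero (W_pos D.toDomains y).ne' (W_pos D.toDomains y').ne'
  have : W D.toDomains y * W D.toDomains y' * XkT D a y y' = W D.toDomains y * W D.toDomains y' * XkT D a y' y := by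
    linarith
  exact mul_left_cancel₀ hW this

end Form

/-! ## §2 The conjugated kernel `B = Λ⁻²W^{½}XW^{½}Λ⁻²`: symmetry, GLOBAL coercivity, entries -/

section Conjugate

variable {ℓ Mh k R : ℕ} {P : Fin (d + 1) → ℕ} (D : TDomains d ℓ Mh k P R) (a : ℕ → ℝ)

/-- `m(y) > 0`. [folklore] -/
private theorem mW_pos (y : ↥(bset D.toDomains)) : 0 < mW D.toDomains y := Real.sqrt_pos.2 (W_pos D.toDomains y)

/-- `m(y)² = W(y)`. [folklore] -/
private theorem mW_sq (y : ↥(bset D.toDomains)) : mW D.toDomains y ^ 2 = W D.toDomains y :=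
  Real.sq_sqrt (W_pos D.toDomains y).le

/-- `n(y) > 0` as a real. [folklore] -/
private theorem nbR_pos (y : ↥(bset D.toDomains)) : (0 : ℝ) < ((nb D.toDomains y : ℕ) : ℝ) := by
  exact_mod_cast one_le_nb D.toDomains y

/-- `c(y) > 0`. [folklore] -/
private theorem cw_pos (y : ↥(bset D.toDomains)) : 0 < cw D.toDomains y :=
  div_pos (mW_pos D y) (pow_pos (nbR_pos D y) 2)

/-- **the conjugated torus kernel** `B(y, y′) = c(y)·X(y, y′)·c(y′)`, `c = W^{½}Λ⁻²` (print's rescaling (2.71)/(2.80) to the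
`ξ = L^{−j}` lattice in `η`-units, symmetrised for [3] Sect. 5). [cite: Balaban1984PropagatorsII, (2.71) p.235, (2.80) p.237] -/
def BmT : Matrix ↥(bset D.toDomains) ↥(bset D.toDomains) ℝ := fun y y' => cw D.toDomains y * XkT D a y y' * cw D.toDomains y'

/-- `B` is symmetric. [cite: Balaban1984PropagatorsII, (2.69) p.235 (self-adjointness)] -/
theorem BmT_isSymm : (BmT D a).IsSymm := by
  ext y y'
  simp only [Matrix.transpose_apply, BmT]
  rw [XkT_symm D a y' y]; ring

/-- **the Euclidean form of `B` is `‖G′Q′*g‖²`** at `g = c·z/W`. [cite: Balaban1984PropagatorsII, (2.72) p.236, (2.78) p.236] -/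
theorem BmT_form (z : ↥(bset D.toDomains) → ℝ) :
    z ⬝ᵥ (BmT D a *ᵥ z) =
      (GmT D a *ᵥ QsB D.toDomains (fun y => cw D.toDomains y / W D.toDomains y * z y)) ⬝ᵥ
        (GmT D a *ᵥ QsB D.toDomains (fun y => cw D.toDomains y / W D.toDomains y * z y)) := by
  rw [← wform_XkT]
  simp only [dotProduct, Matrix.mulVec, BmT, kerOp_apply, Finset.mul_sum]
  refine Finset.sum_congr rfl fun y _ => Finset.sum_congr rfl fun y' _ => ?_
  have hW := (W_pos D.toDomains y).ne'
  have hW' := (W_pos D.toDomains y').ne'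
  field_simp

/-- **(2.78) FOR `B`, GLOBALLY ON `𝔅`**: `zᵀBz ≥ C₄⁻¹‖z‖²` for EVERY `z` (file 2's level-weighted coercivity of `Q′G′²Q′*`
on the whole torus block lattice). [cite: Balaban1984PropagatorsII, (2.78) p.236] -/
theorem BmT_coercive (hℓ : 1 ≤ ℓ) (hMh : 1 ≤ Mh) (hP : ∀ μ, 1 ≤ P μ) {aplus : ℝ} (ha : ∀ j, 0 < a j)
    (hale : ∀ j, a j ≤ aplus) (z : ↥(bset D.toDomains) → ℝ) :
    (C4 d aplus)⁻¹ * ∑ y, z y ^ 2 ≤ z ⬝ᵥ (BmT D a *ᵥ z) := by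
  rw [BmT_form]
  set g : ↥(bset D.toDomains) → ℝ := fun y => cw D.toDomains y / W D.toDomains y * z y with hg
  have h := qggq_coercive_multiLevelTorus D g hℓ hMh hP ha hale
  have hsum : ∑ y, W D.toDomains y * ((nb D.toDomains y : ℕ) : ℝ) ^ 4 * g y ^ 2 = ∑ y, z y ^ 2 := by
    refine Finset.sum_congr rfl fun y _ => ?_
    rw [hg]; dsimp only
    have hn := (nbR_pos D y).ne'
    have hm0 := (mW_pos D y).ne'
    rw [← mW_sq D y]
    unfold cw
    field_simp
  rw [hsum] at h
  exact h

/-- `max{|j − j′| − 1, 0}` of the torus chain geometry is `|j − j′| − 1` (truncated). [cite: Balaban1984PropagatorsII, (2.60) p.234, dictionary] -/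
theorem mx_eq_lgap_T (y y' : ↥(B6Geom246MultiLevelBoxL0.bset D.toDomains)) : mx (geomTB D) y y' = ((lgap D.toDomains y y' - 1 : ℕ) : ℝ) := by
  unfold mx lgap
  have hscale : ∀ z : ↥(bset D.toDomains), ((geomTB D).scale z : ℝ) = (z.1.1 : ℝ) := fun z => rfl
  rw [hscale, hscale]
  have habs : |(y.1.1 : ℝ) - y'.1.1| = ((Int.natAbs ((y.1.1 : ℤ) - y'.1.1) : ℕ) : ℝ) := by
    rw [Nat.cast_natAbs]; push_cast; rfl
  rw [habs]
  rcases Nat.eq_zero_or_pos (Int.natAbs ((y.1.1 : ℤ) - y'.1.1)) with h0 | h0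
  · rw [h0]; simp
  · have h1 : (1 : ℝ) ≤ ((Int.natAbs ((y.1.1 : ℤ) - y'.1.1) : ℕ) : ℝ) := by exact_mod_cast h0
    rw [Nat.cast_sub h0, max_eq_left (by linarith)]
    push_cast; ring

/-- **(2.60) ON THE TORUS IN LEVEL-GAP FORM**: `(R·L·M_h − 1)·(|j − j′| − 1)₊ ≤ d_T(y, y′)`. [cite: Balaban1984PropagatorsII, (2.60) p.234, (2.2) p.224] -/
theorem levelGap_le_distT (hMh : 1 ≤ Mh) (hP : ∀ μ, 1 ≤ P μ) (hRM : 1 ≤ R * ((ℓ + 1) * Mh))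
    (y y' : ↥(B6Geom246MultiLevelBoxL0.bset D.toDomains)) :
    ((R : ℝ) * (((ℓ : ℝ) + 1) * Mh) - 1) * ((lgap D.toDomains y y' - 1 : ℕ) : ℝ) ≤ (geomT D).dist y y' := by
  have hsep := levelSepTB D hMh hP hRM y y'
  rw [geomTB_RM D hMh, mx_eq_lgap_T] at hsep
  exact hsep

/-- the level ratio of the conjugation: `(n(y)/n(y′))²·(m(y)/m(y′)) ≤ (L^{d+3})^{|j−j′|}` (blocks of a torus family are
blocks of its fundamental box). [cite: Balaban1984PropagatorsII, (2.68) p.235 (the factors L^{2(j″−j)}), bookkeeping] -/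
theorem ratio_le_T (hℓ : 1 ≤ ℓ) (y y' : ↥(B6Geom246MultiLevelBoxL0.bset D.toDomains)) :
    (((nb D.toDomains y : ℕ) : ℝ) / ((nb D.toDomains y' : ℕ) : ℝ)) ^ 2 * (mW D.toDomains y / mW D.toDomains y')
      ≤ (((ℓ : ℝ) + 1) ^ (d + 3)) ^ lgap D.toDomains y y' :=
  B6Ineq281MultiLevelBoxL0.ratio_le D.toDomains hℓ y y'

/-- the absorption: `(L^p)^{n}·e^{−β·N·(n−1)} ≤ L^p` once `L^p·e^{−βN} ≤ 1` (`n − 1` truncated). [folklore] -/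
private theorem pow_absorb {Lp β N : ℝ} (hLp : 1 ≤ Lp) (hsmall : Lp * Real.exp (-(β * N)) ≤ 1) (n : ℕ) :
    Lp ^ n * Real.exp (-(β * N * ((n - 1 : ℕ) : ℝ))) ≤ Lp := by
  rcases Nat.eq_zero_or_pos n with h0 | h0
  · subst h0; simp; exact hLp
  · obtain ⟨m, rfl⟩ : ∃ m, n = m + 1 := ⟨n - 1, by omega⟩
    rw [Nat.add_sub_cancel, pow_succ, show -(β * N * (m : ℝ)) = (m : ℕ) * (-(β * N)) by ring,
      Real.exp_nat_mul]
    have h0' : 0 ≤ Lp * Real.exp (-(β * N)) := by positivity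
    calc Lp ^ m * Lp * Real.exp (-(β * N)) ^ m = Lp * (Lp * Real.exp (-(β * N))) ^ m := by rw [mul_pow]; ring
      _ ≤ Lp * 1 := mul_le_mul_of_nonneg_left (pow_le_one₀ h0' hsmall) (by linarith)
      _ = Lp := mul_one _

/-- **the entries of `B`**: from the torus (2.68) `|X(y, y′)| ≤ C(L^j)⁴W(y′)⁻¹e^{−¼δ₀d_T}` and the torus (2.60),
under `L^{d+3}e^{−(δ₀/8)(RM−1)} ≤ 1`: `|B(y, y′)| ≤ C·L^{d+3}·e^{−(δ₀/8)d_T(y,y′)}` — uniformly in the levels.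
[cite: Balaban1984PropagatorsII, (2.68) p.235, (2.60) p.234, (2.79)–(2.80) p.237] -/
theorem BmT_entry_le (hℓ : 1 ≤ ℓ) (hMh : 1 ≤ Mh) (hP : ∀ μ, 1 ≤ P μ) (hRM : 1 ≤ R * ((ℓ + 1) * Mh)) {C δ₀ : ℝ}
    (hC : 0 ≤ C) (hδ₀ : 0 ≤ δ₀)
    (hX : ∀ y y', |XkT D a y y'| ≤ C * (geomT D).len y ^ 4 * ((geomT D).len y' ^ (d + 1))⁻¹ *
      Real.exp (-(δ₀ / 4 * (geomT D).dist y y')))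
    (hsmall : ((ℓ : ℝ) + 1) ^ (d + 3) * Real.exp (-(δ₀ / 8 * ((R : ℝ) * (((ℓ : ℝ) + 1) * Mh) - 1))) ≤ 1)
    (y y' : ↥(bset D.toDomains)) :
    |BmT D a y y'| ≤ C * ((ℓ : ℝ) + 1) ^ (d + 3) * Real.exp (-(δ₀ / 8 * (geomT D).dist y y')) := by
  have hL1 : (1 : ℝ) ≤ (ℓ : ℝ) + 1 := by linarith [(Nat.cast_nonneg ℓ : (0 : ℝ) ≤ ℓ)]
  have hlen : ∀ z : ↥(bset D.toDomains), (geomT D).len z = ((nb D.toDomains z : ℕ) : ℝ) := fun z => by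
    rw [lenT_eq]; unfold nb; push_cast; ring
  have hn := nbR_pos D y
  have hn' := nbR_pos D y'
  have hm := mW_pos D y
  have hm' := mW_pos D y'
  have h1 : |BmT D a y y'| ≤ C * ((((nb D.toDomains y : ℕ) : ℝ) / ((nb D.toDomains y' : ℕ) : ℝ)) ^ 2 *
      (mW D.toDomains y / mW D.toDomains y')) * Real.exp (-(δ₀ / 4 * (geomT D).dist y y')) := by
    have hx := hX y y'
    rw [hlen, hlen] at hx
    have hWm : ((nb D.toDomains y' : ℕ) : ℝ) ^ (d + 1) = mW D.toDomains y' ^ 2 := by rw [mW_sq, W_eq_nb_pow]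
    rw [hWm] at hx
    unfold BmT
    rw [abs_mul, abs_mul, abs_of_pos (cw_pos D y), abs_of_pos (cw_pos D y')]
    have hcalc : cw D.toDomains y * (C * ((nb D.toDomains y : ℕ) : ℝ) ^ 4 * (mW D.toDomains y' ^ 2)⁻¹ *
        Real.exp (-(δ₀ / 4 * (geomT D).dist y y'))) * cw D.toDomains y'
        = C * ((((nb D.toDomains y : ℕ) : ℝ) / ((nb D.toDomains y' : ℕ) : ℝ)) ^ 2 *
          (mW D.toDomains y / mW D.toDomains y')) * Real.exp (-(δ₀ / 4 * (geomT D).dist y y')) := by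
      unfold cw
      field_simp
    rw [← hcalc]
    exact mul_le_mul_of_nonneg_right (mul_le_mul_of_nonneg_left hx (cw_pos D y).le) (cw_pos D y').le
  have h2 := ratio_le_T D hℓ y y'
  have hsep := levelGap_le_distT D hMh hP hRM y y'
  have hsplit : Real.exp (-(δ₀ / 4 * (geomT D).dist y y')) =
      Real.exp (-(δ₀ / 8 * (geomT D).dist y y')) * Real.exp (-(δ₀ / 8 * (geomT D).dist y y')) := by
    rw [← Real.exp_add]; congr 1; ring
  have hexp2 : Real.exp (-(δ₀ / 8 * (geomT D).dist y y')) ≤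
      Real.exp (-(δ₀ / 8 * ((R : ℝ) * (((ℓ : ℝ) + 1) * Mh) - 1) * ((lgap D.toDomains y y' - 1 : ℕ) : ℝ))) := by
    rw [Real.exp_le_exp, neg_le_neg_iff, mul_assoc]
    exact mul_le_mul_of_nonneg_left hsep (by positivity)
  have habs := pow_absorb (Lp := ((ℓ : ℝ) + 1) ^ (d + 3)) (β := δ₀ / 8)
    (N := (R : ℝ) * (((ℓ : ℝ) + 1) * Mh) - 1) (one_le_pow₀ hL1) hsmall (lgap D.toDomains y y')
  have hE0 : 0 ≤ Real.exp (-(δ₀ / 8 * (geomT D).dist y y')) := (Real.exp_pos _).le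
  calc |BmT D a y y'| ≤ _ := h1
    _ ≤ C * (((ℓ : ℝ) + 1) ^ (d + 3)) ^ lgap D.toDomains y y' * Real.exp (-(δ₀ / 4 * (geomT D).dist y y')) :=
        mul_le_mul_of_nonneg_right (mul_le_mul_of_nonneg_left h2 hC) (Real.exp_pos _).le
    _ = C * ((((ℓ : ℝ) + 1) ^ (d + 3)) ^ lgap D.toDomains y y' * Real.exp (-(δ₀ / 8 * (geomT D).dist y y'))) *
          Real.exp (-(δ₀ / 8 * (geomT D).dist y y')) := by rw [hsplit]; ring
    _ ≤ C * ((((ℓ : ℝ) + 1) ^ (d + 3)) ^ lgap D.toDomains y y' *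
          Real.exp (-(δ₀ / 8 * ((R : ℝ) * (((ℓ : ℝ) + 1) * Mh) - 1) * ((lgap D.toDomains y y' - 1 : ℕ) : ℝ)))) *
          Real.exp (-(δ₀ / 8 * (geomT D).dist y y')) :=
        mul_le_mul_of_nonneg_right (mul_le_mul_of_nonneg_left
          (mul_le_mul_of_nonneg_left hexp2 (by positivity)) hC) hE0
    _ ≤ C * ((ℓ : ℝ) + 1) ^ (d + 3) * Real.exp (-(δ₀ / 8 * (geomT D).dist y y')) := by
        have := mul_le_mul_of_nonneg_left habs hC
        nlinarith [hE0]

end Conjugate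

/-! ## §3 [3] Sect. 5, (5.6) ⇒ (5.7), on the WHOLE torus block lattice -/

section Sect5

variable {ℓ Mh k R : ℕ} {P : Fin (d + 1) → ℕ} (D : TDomains d ℓ Mh k P R) (a : ℕ → ℝ)

/-- the torus distance (2.46) is a pseudo-distance (symmetric, zero diagonal, (2.54)). [cite: Balaban1984PropagatorsII, (2.46) p.231, (2.54) p.233] -/
theorem isPseudoDist_distT (hMh : 1 ≤ Mh) (hP : ∀ μ, 1 ≤ P μ) :
    IsPseudoDist (fun y y' : ↥(B6Geom246MultiLevelBoxL0.bset D.toDomains) => (geomT D).dist y y') :=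
  ⟨fun y y' => symmT D y y', (triangle_refl_nonneg_T D hMh hP).2.1,
   fun y y' y'' => (triangle_refl_nonneg_T D hMh hP).1 y y' y''⟩

/-- **the profile bound `Σ_{y′} e^{−t·d_T(y,y′)} ≤ K(t)`** for every `t > 0`, from the torus (2.61) at `α = 1/16`.
[cite: Balaban1984PropagatorsII, Lemma 2.1 (2.61) p.234] -/
theorem sumBound_torus (hMh : 1 ≤ Mh) (hP : ∀ μ, 1 ≤ P μ) {δ₀ c : ℝ}
    (h261 : Ineq261With c (B6Geom246MultiLevelTorusL0.geomT D) δ₀ (1 / 16)) :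
    SumBound (fun y y' : ↥(bset D.toDomains) => (geomT D).dist y y') (Kprof δ₀ c (Fintype.card ↥(bset D.toDomains))) := by
  intro t ht y
  have hd0 : ∀ y', 0 ≤ (geomT D).dist y y' := (triangle_refl_nonneg_T D hMh hP).2.2 y
  unfold Kprof
  split_ifs with hle
  · refine le_trans (Finset.sum_le_sum fun y' _ => ?_) (h261 y)
    rw [Real.exp_le_exp]
    have := mul_le_mul_of_nonneg_right hle (hd0 y')
    linarith
  · calc ∑ y', Real.exp (-(t * (geomT D).dist y y')) ≤ ∑ _y' : ↥(bset D.toDomains), (1 : ℝ) :=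
          Finset.sum_le_sum fun y' _ => by
            rw [Real.exp_le_one_iff, neg_nonpos]; exact mul_nonneg ht.le (hd0 y')
      _ = Fintype.card ↥(bset D.toDomains) := by simp

/-- **(5.6) FOR `B` ON ALL OF `𝔅`**: symmetric, coercive with `γ_B = C₄⁻¹`, entries `≤ CL^{d+3}e^{−(δ₀/8)d_T}`.
[cite: Balaban1983RegularityDecay, (5.6) p.594; Balaban1984PropagatorsII, (2.78)–(2.79) p.236–237] -/
theorem hyp56_BmT (hℓ : 1 ≤ ℓ) (hMh : 1 ≤ Mh) (hP : ∀ μ, 1 ≤ P μ) (hRM : 1 ≤ R * ((ℓ + 1) * Mh)) {aplus : ℝ}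
    (ha : ∀ j, 0 < a j) (hale : ∀ j, a j ≤ aplus) {C δ₀ : ℝ} (hC : 0 ≤ C) (hδ₀ : 0 ≤ δ₀)
    (hX : ∀ y y', |XkT D a y y'| ≤ C * (geomT D).len y ^ 4 * ((geomT D).len y' ^ (d + 1))⁻¹ *
      Real.exp (-(δ₀ / 4 * (geomT D).dist y y')))
    (hsmall : ((ℓ : ℝ) + 1) ^ (d + 3) * Real.exp (-(δ₀ / 8 * ((R : ℝ) * (((ℓ : ℝ) + 1) * Mh) - 1))) ≤ 1) :
    Hyp56 (fun y y' : ↥(bset D.toDomains) => (geomT D).dist y y') (BmT D a) (C4 d aplus)⁻¹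
      (C * ((ℓ : ℝ) + 1) ^ (d + 3)) (δ₀ / 8) := by
  refine ⟨BmT_isSymm D a, fun v => ?_, BmT_entry_le D a hℓ hMh hP hRM hC hδ₀ hX hsmall⟩
  have h := BmT_coercive D a hℓ hMh hP ha hale v
  unfold dotProduct at h
  exact h

/-- **`B` IS INVERTIBLE — for every member, no threshold** («Of course the operator Q′G′²Q′* is positive definite, so
its inverse is well defined»): coercivity alone. [cite: Balaban1984PropagatorsII, p.235 (before (2.70))] -/
theorem isUnit_BmT (hℓ : 1 ≤ ℓ) (hMh : 1 ≤ Mh) (hP : ∀ μ, 1 ≤ P μ) {aplus : ℝ} (ha : ∀ j, 0 < a j)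
    (hale : ∀ j, a j ≤ aplus) : IsUnit (BmT D a) := by
  refine QGQInverse.isUnit_of_coercive (inv_pos.2 (C4_pos d aplus)) fun z => ?_
  have h := BmT_coercive D a hℓ hMh hP ha hale z
  have e1 : z ⬝ᵥ z = ∑ y, z y ^ 2 := by simp [dotProduct, pow_two]
  rw [e1]; exact h

/-- **(5.7) FOR `B` ON ALL OF `𝔅`** («the theory developed in Sect. 5 [3]»): `|B⁻¹(y, y′)| ≤ 2C₄e^{−δ₁d_T(y,y′)}`,
`δ₁ = rate(K, C₄⁻¹, CL^{d+3}, δ₀/8)`. [cite: Balaban1984PropagatorsII, (2.79) p.237; Balaban1983RegularityDecay, (5.7) p.594] -/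
theorem invBmT_decay (hℓ : 1 ≤ ℓ) (hMh : 1 ≤ Mh) (hP : ∀ μ, 1 ≤ P μ) (hRM : 1 ≤ R * ((ℓ + 1) * Mh)) {aplus : ℝ}
    (ha : ∀ j, 0 < a j) (hale : ∀ j, a j ≤ aplus) {C δ₀ c16 : ℝ} (hC : 0 ≤ C) (hδ₀ : 0 < δ₀)
    (hc16 : 0 ≤ c16)
    (hX : ∀ y y', |XkT D a y y'| ≤ C * (geomT D).len y ^ 4 * ((geomT D).len y' ^ (d + 1))⁻¹ *
      Real.exp (-(δ₀ / 4 * (geomT D).dist y y')))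
    (hsmall : ((ℓ : ℝ) + 1) ^ (d + 3) * Real.exp (-(δ₀ / 8 * ((R : ℝ) * (((ℓ : ℝ) + 1) * Mh) - 1))) ≤ 1)
    (h261 : Ineq261With c16 (geomT D) δ₀ (1 / 16)) (y y' : ↥(bset D.toDomains)) :
    |(BmT D a)⁻¹ y y'| ≤ 2 / (C4 d aplus)⁻¹ *
      Real.exp (-(rate (Kprof δ₀ c16 (Fintype.card ↥(bset D.toDomains))) (C4 d aplus)⁻¹
        (C * ((ℓ : ℝ) + 1) ^ (d + 3)) (δ₀ / 8) * (geomT D).dist y y')) :=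
  inv_decay (fun t ht => by unfold Kprof; split_ifs; exacts [hc16, Nat.cast_nonneg _]) (inv_pos.2 (C4_pos d aplus))
    (by positivity) (by positivity) (isPseudoDist_distT D hMh hP) (sumBound_torus D hMh hP h261)
    (hyp56_BmT D a hℓ hMh hP hRM ha hale hC hδ₀.le hX hsmall) y y'

end Sect5

/-! ## §4 The inverse `(Q′G′²Q′*)⁻¹` as a (2.69)-kernel: the conjugation undone -/

section Inverse

variable {ℓ Mh k R : ℕ} {P : Fin (d + 1) → ℕ} (D : TDomains d ℓ Mh k P R) (a : ℕ → ℝ)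

/-- **THE (2.69)-KERNEL OF `(Q′G′²Q′*)⁻¹` ON THE TORUS**: `C(y, y′) = (c(y)/W(y))·B⁻¹(y, y′)·(c(y′)/W(y′))`.
[cite: Balaban1984PropagatorsII, Prop. 2.3 (2.86)–(2.87) p.238] -/
def CinvT : ↥(bset D.toDomains) → ↥(bset D.toDomains) → ℝ := fun y y' =>
  cw D.toDomains y / W D.toDomains y * (BmT D a)⁻¹ y y' * (cw D.toDomains y' / W D.toDomains y')

/-- **`(Q′G′²Q′*)⁻¹` AS AN OPERATOR ON `ℝ^𝔅`** (pairing (2.69)). [cite: Balaban1984PropagatorsII, Prop. 2.3 (2.86) p.238] -/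
def GinvT : Module.End ℝ (↥(bset D.toDomains) → ℝ) := kerOp (W D.toDomains) (CinvT D a)

/-- the kernel of `GinvT` read back: `mat GinvT y y′ / W(y′) = C(y, y′)`. [cite: Balaban1984PropagatorsII, (2.69) p.235, dictionary] -/
theorem mat_GinvT_div (y y' : ↥(bset D.toDomains)) : mat (GinvT D a) y y' / W D.toDomains y' = CinvT D a y y' := by
  unfold GinvT; rw [mat_kerOp, mul_div_cancel_left₀ _ (W_pos D.toDomains y').ne']

/-- `X(y, y″) = B(y, y″)/(c(y)c(y″))`. [folklore] -/
private theorem XkT_eq_BmT (y y'' : ↥(bset D.toDomains)) :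
    XkT D a y y'' = BmT D a y y'' / (cw D.toDomains y * cw D.toDomains y'') := by
  unfold BmT
  have h1 := (cw_pos D y).ne'
  have h2 := (cw_pos D y'').ne'
  field_simp

/-- the key contraction: `W(y′)·Σ_{y″} W(y″)X(y, y″)C(y″, y′) = δ_{yy′}` (`BB⁻¹ = 1` conjugated).
[cite: Balaban1984PropagatorsII, Prop. 2.3 (2.86) p.238] -/
theorem sum_WXC (hU : IsUnit (BmT D a)) (y y' : ↥(bset D.toDomains)) :
    W D.toDomains y' * ∑ y'', W D.toDomains y'' * XkT D a y y'' * CinvT D a y'' y' = if y = y' then 1 else 0 := by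
  classical
  have hterm : ∀ q : ↥(bset D.toDomains), W D.toDomains q * XkT D a y q * CinvT D a q y'
      = (BmT D a y q * (BmT D a)⁻¹ q y') * (cw D.toDomains y' / (cw D.toDomains y * W D.toDomains y')) := by
    intro q
    unfold CinvT
    rw [XkT_eq_BmT]
    have h1 := (cw_pos D y).ne'
    have h2 := (cw_pos D q).ne'
    have h3 := (W_pos D.toDomains q).ne'
    have h4 := (W_pos D.toDomains y').ne'
    field_simp
  rw [Finset.sum_congr rfl fun q _ => hterm q, ← Finset.sum_mul, ← Matrix.mul_apply,
    Matrix.mul_nonsing_inv _ ((Matrix.isUnit_iff_isUnit_det _).mp hU), Matrix.one_apply]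
  have h1 := (cw_pos D y').ne'
  have h4 := (W_pos D.toDomains y').ne'
  by_cases hyy : y = y'
  · subst hyy; rw [if_pos rfl]; field_simp
  · rw [if_neg hyy]; ring

/-- **`Q′G′²Q′*·(Q′G′²Q′*)⁻¹ = 1`** on `ℝ^𝔅`. [cite: Balaban1984PropagatorsII, Prop. 2.3 (2.86) p.238] -/
theorem X_mul_GinvT (hU : IsUnit (BmT D a)) : kerOp (W D.toDomains) (XkT D a) * GinvT D a = 1 := by
  classical
  refine LinearMap.ext fun μ => funext fun y => ?_
  unfold GinvT
  simp only [Module.End.mul_apply, kerOp_apply, Module.End.one_apply]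
  have hre : ∑ y'', W D.toDomains y'' * XkT D a y y'' * (∑ y', W D.toDomains y' * CinvT D a y'' y' * μ y')
      = ∑ y', μ y' * (W D.toDomains y' * ∑ y'', W D.toDomains y'' * XkT D a y y'' * CinvT D a y'' y') := by
    simp only [Finset.mul_sum]
    rw [Finset.sum_comm]
    exact Finset.sum_congr rfl fun y' _ => Finset.sum_congr rfl fun y'' _ => by ring
  rw [hre, Finset.sum_congr rfl fun y' _ => by rw [sum_WXC D a hU y y']]
  simp [Finset.sum_ite_eq]

/-- **`(Q′G′²Q′*)⁻¹·Q′G′²Q′* = 1`** on `ℝ^𝔅` (finite dimension). [cite: Balaban1984PropagatorsII, Prop. 2.3 (2.86) p.238] -/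
theorem GinvT_mul_X (hU : IsUnit (BmT D a)) : GinvT D a * kerOp (W D.toDomains) (XkT D a) = 1 :=
  mul_eq_one_comm.1 (X_mul_GinvT D a hU)

/-- **uniqueness**: every left inverse of `Q′G′²Q′*` is `GinvT`. [cite: Balaban1984PropagatorsII, p.235 («its inverse is well defined»)] -/
theorem GinvT_unique (hU : IsUnit (BmT D a)) (G' : Module.End ℝ (↥(bset D.toDomains) → ℝ))
    (hG' : G' * kerOp (W D.toDomains) (XkT D a) = 1) : G' = GinvT D a := by
  calc G' = G' * (kerOp (W D.toDomains) (XkT D a) * GinvT D a) := by rw [X_mul_GinvT D a hU, mul_one]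
    _ = GinvT D a := by rw [← mul_assoc, hG', one_mul]

/-- **THE LEVEL WEIGHTS OF THE CONJUGATION, PRINT'S SHAPE**: `(c(y)/W(y))·(c(y′)/W(y′)) ≤ (L^{d+3})^{|j−j′|}·(L^j)^{−4}·W(y′)⁻¹`.
[cite: Balaban1984PropagatorsII, (2.80)–(2.81) p.237, (2.87) p.238 (the factors (L^jη)^{−4}(L^{j′}η)^{−d})] -/
theorem cwW_mul_le_T (hℓ : 1 ≤ ℓ) (y y' : ↥(B6Geom246MultiLevelBoxL0.bset D.toDomains)) :
    cw D.toDomains y / W D.toDomains y * (cw D.toDomains y' / W D.toDomains y')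
      ≤ (((ℓ : ℝ) + 1) ^ (d + 3)) ^ lgap D.toDomains y y' *
        ((((nb D.toDomains y : ℕ) : ℝ) ^ 4)⁻¹ * (W D.toDomains y')⁻¹) := by
  have hL1 : (1 : ℝ) ≤ (ℓ : ℝ) + 1 := by linarith [(Nat.cast_nonneg ℓ : (0 : ℝ) ≤ ℓ)]
  have hL0 : (0 : ℝ) < (ℓ : ℝ) + 1 := by positivity
  have hn := nbR_pos D y
  have hn' := nbR_pos D y'
  have hm := mW_pos D y
  have hm' := mW_pos D y'
  have hW' := W_pos D.toDomains y'
  -- `(c/W)(c′/W′) = 1/(n²m·n′²m′)` and the target is `Λ^{gap}/(n⁴·m′²)`: the ratio is `(n/n′)²·(m′/m) ≤ Λ^{gap}`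
  have hcw : ∀ z : ↥(bset D.toDomains), cw D.toDomains z / W D.toDomains z = (((nb D.toDomains z : ℕ) : ℝ) ^ 2 * mW D.toDomains z)⁻¹ := by
    intro z
    unfold cw
    rw [← mW_sq D z]
    have h1 := (mW_pos D z).ne'
    have h2 := (nbR_pos D z).ne'
    field_simp
  rw [hcw, hcw, ← mW_sq D y']
  -- the swapped ratio `(n/n′)²·(m′/m) ≤ (L^{d+3})^{gap}`
  set t : ℝ := ((nb D.toDomains y : ℕ) : ℝ) / ((nb D.toDomains y' : ℕ) : ℝ) with ht
  have ht0 : 0 < t := div_pos hn hn'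
  have hgapsymm : lgap D.toDomains y' y = lgap D.toDomains y y' := by
    unfold lgap; rw [← Int.natAbs_neg]; congr 1; ring
  have htL : t ≤ ((ℓ : ℝ) + 1) ^ lgap D.toDomains y y' := by
    rw [ht]; unfold nb lgap
    push_cast
    rw [div_le_iff₀ (by positivity), ← pow_add]
    exact pow_le_pow_right₀ hL1 (by omega)
  have htL' : t⁻¹ ≤ ((ℓ : ℝ) + 1) ^ lgap D.toDomains y y' := by
    rw [ht, inv_div]; unfold nb lgap
    push_cast
    rw [div_le_iff₀ (by positivity), ← pow_add]
    exact pow_le_pow_right₀ hL1 (by omega)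
  have hm_ratio : mW D.toDomains y' / mW D.toDomains y = Real.sqrt (t⁻¹ ^ (d + 1)) := by
    unfold mW
    rw [← Real.sqrt_div' _ (W_pos D.toDomains y).le, W_eq_nb_pow, W_eq_nb_pow, ← div_pow, ht, inv_div]
  have hkey : t ^ 2 * (mW D.toDomains y' / mW D.toDomains y) ≤ (((ℓ : ℝ) + 1) ^ (d + 3)) ^ lgap D.toDomains y y' := by
    rw [hm_ratio]
    have hpowL : (1 : ℝ) ≤ (((ℓ : ℝ) + 1) ^ (d + 3)) ^ lgap D.toDomains y y' := one_le_pow₀ (one_le_pow₀ hL1)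
    rcases le_or_gt 1 t with h1 | h1
    · -- `t ≥ 1`: `√(t⁻¹^{d+1}) ≤ 1`, `t² ≤ (L^{gap})² ≤ (L^{d+3})^{gap}`
      have hinv : t⁻¹ ≤ 1 := inv_le_one_of_one_le₀ h1
      have hs : Real.sqrt (t⁻¹ ^ (d + 1)) ≤ 1 := Real.sqrt_le_one.mpr (pow_le_one₀ (inv_nonneg.2 ht0.le) hinv)
      calc t ^ 2 * Real.sqrt (t⁻¹ ^ (d + 1)) ≤ t ^ 2 * 1 := mul_le_mul_of_nonneg_left hs (by positivity)
        _ ≤ (((ℓ : ℝ) + 1) ^ lgap D.toDomains y y') ^ 2 := by rw [mul_one]; exact pow_le_pow_left₀ ht0.le htL 2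
        _ = (((ℓ : ℝ) + 1) ^ 2) ^ lgap D.toDomains y y' := by rw [← pow_mul, ← pow_mul, mul_comm]
        _ ≤ (((ℓ : ℝ) + 1) ^ (d + 3)) ^ lgap D.toDomains y y' :=
            pow_le_pow_left₀ (by positivity) (pow_le_pow_right₀ hL1 (by omega)) _
    · -- `t < 1`: `t² ≤ 1`, `√(t⁻¹^{d+1}) ≤ t⁻¹^{d+1} ≤ (L^{gap})^{d+1} ≤ (L^{d+3})^{gap}`
      have hge : (1 : ℝ) ≤ t⁻¹ := (one_le_inv₀ ht0).2 h1.le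
      have hge' : (1 : ℝ) ≤ t⁻¹ ^ (d + 1) := one_le_pow₀ hge
      have hs : Real.sqrt (t⁻¹ ^ (d + 1)) ≤ t⁻¹ ^ (d + 1) := by
        rw [Real.sqrt_le_left (by positivity)]; nlinarith
      calc t ^ 2 * Real.sqrt (t⁻¹ ^ (d + 1)) ≤ 1 * t⁻¹ ^ (d + 1) :=
            mul_le_mul (pow_le_one₀ ht0.le h1.le) hs (Real.sqrt_nonneg _) zero_le_one
        _ ≤ (((ℓ : ℝ) + 1) ^ lgap D.toDomains y y') ^ (d + 1) := by
            rw [one_mul]; exact pow_le_pow_left₀ (inv_nonneg.2 ht0.le) htL' _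
        _ = (((ℓ : ℝ) + 1) ^ (d + 1)) ^ lgap D.toDomains y y' := by rw [← pow_mul, ← pow_mul, mul_comm]
        _ ≤ (((ℓ : ℝ) + 1) ^ (d + 3)) ^ lgap D.toDomains y y' :=
            pow_le_pow_left₀ (by positivity) (pow_le_pow_right₀ hL1 (by omega)) _
  -- assemble: `1/(n²m) · 1/(n′²m′) = [t²·(m′/m)] / (n⁴·m′²)`
  have e : (((nb D.toDomains y : ℕ) : ℝ) ^ 2 * mW D.toDomains y)⁻¹ * (((nb D.toDomains y' : ℕ) : ℝ) ^ 2 * mW D.toDomains y')⁻¹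
      = (t ^ 2 * (mW D.toDomains y' / mW D.toDomains y)) *
        ((((nb D.toDomains y : ℕ) : ℝ) ^ 4)⁻¹ * (mW D.toDomains y' ^ 2)⁻¹) := by
    rw [ht]; field_simp
  rw [e]
  exact mul_le_mul_of_nonneg_right hkey (by positivity)

/-- **(2.87) ON THE TORUS, CONDITIONAL FORM**: under the torus (2.68), the torus (2.61) at `α = 1/16` and the two
absorption thresholds, `|C(y, y′)| ≤ 2C₄L^{d+3}·(L^j)^{−4}·W(y′)⁻¹·e^{−½δ₁d_T(y,y′)}`, `δ₁` the [3] Sect. 5 rate.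
[cite: Balaban1984PropagatorsII, Prop. 2.3 (2.87) p.238, (2.79)–(2.81) p.237; Balaban1983RegularityDecay, (5.7) p.594] -/
theorem CinvT_decay (hℓ : 1 ≤ ℓ) (hMh : 1 ≤ Mh) (hP : ∀ μ, 1 ≤ P μ) (hRM : 1 ≤ R * ((ℓ + 1) * Mh)) {aplus : ℝ}
    (ha : ∀ j, 0 < a j) (hale : ∀ j, a j ≤ aplus) {C δ₀ c16 : ℝ} (hC : 0 ≤ C) (hδ₀ : 0 < δ₀)
    (hc16 : 0 ≤ c16)
    (hX : ∀ y y', |XkT D a y y'| ≤ C * (geomT D).len y ^ 4 * ((geomT D).len y' ^ (d + 1))⁻¹ *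
      Real.exp (-(δ₀ / 4 * (geomT D).dist y y')))
    (hsmall : ((ℓ : ℝ) + 1) ^ (d + 3) * Real.exp (-(δ₀ / 8 * ((R : ℝ) * (((ℓ : ℝ) + 1) * Mh) - 1))) ≤ 1)
    (h261 : Ineq261With c16 (geomT D) δ₀ (1 / 16))
    (hsmall1 : ((ℓ : ℝ) + 1) ^ (d + 3) * Real.exp (-(rate (fun _ => c16) (C4 d aplus)⁻¹ (C * ((ℓ : ℝ) + 1) ^ (d + 3))
      (δ₀ / 8) / 2 * ((R : ℝ) * (((ℓ : ℝ) + 1) * Mh) - 1))) ≤ 1)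
    (y y' : ↥(bset D.toDomains)) :
    |CinvT D a y y'| ≤ 2 / (C4 d aplus)⁻¹ * ((ℓ : ℝ) + 1) ^ (d + 3) * ((geomT D).len y ^ 4)⁻¹ *
      ((geomT D).len y' ^ (d + 1))⁻¹ *
      Real.exp (-(rate (fun _ => c16) (C4 d aplus)⁻¹ (C * ((ℓ : ℝ) + 1) ^ (d + 3)) (δ₀ / 8) / 2 *
        (geomT D).dist y y')) := by
  have hL1 : (1 : ℝ) ≤ (ℓ : ℝ) + 1 := by linarith [(Nat.cast_nonneg ℓ : (0 : ℝ) ≤ ℓ)]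
  set δ₁ := rate (fun _ => c16) (C4 d aplus)⁻¹ (C * ((ℓ : ℝ) + 1) ^ (d + 3)) (δ₀ / 8) with hδ₁
  have hδ₁0 : 0 < δ₁ := rate_pos (K := fun _ => c16) (fun _ _ => hc16) (inv_pos.2 (C4_pos d aplus)) (by positivity)
    (by positivity)
  have hinv := invBmT_decay D a hℓ hMh hP hRM ha hale hC hδ₀ hc16 hX hsmall h261 y y'
  rw [rate_Kprof, ← hδ₁] at hinv
  have hwt := cwW_mul_le_T D hℓ y y'
  have hsep := levelGap_le_distT D hMh hP hRM y y'
  have hlen : (geomT D).len y ^ 4 = ((nb D.toDomains y : ℕ) : ℝ) ^ 4 := by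
    rw [lenT_eq]; unfold nb; push_cast; ring
  have hlen' : (geomT D).len y' ^ (d + 1) = W D.toDomains y' := by rw [lenT_eq, W_eq]
  rw [hlen, hlen']
  unfold CinvT
  have e : cw D.toDomains y / W D.toDomains y * (BmT D a)⁻¹ y y' * (cw D.toDomains y' / W D.toDomains y') =
      (cw D.toDomains y / W D.toDomains y * (cw D.toDomains y' / W D.toDomains y')) * (BmT D a)⁻¹ y y' := by ring
  rw [e, abs_mul, abs_of_pos (mul_pos (div_pos (cw_pos D y) (W_pos D.toDomains y))
    (div_pos (cw_pos D y') (W_pos D.toDomains y')))]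
  -- split the rate and absorb the level ratio by (2.60)
  have hsplit : Real.exp (-(δ₁ * (geomT D).dist y y')) =
      Real.exp (-(δ₁ / 2 * (geomT D).dist y y')) * Real.exp (-(δ₁ / 2 * (geomT D).dist y y')) := by
    rw [← Real.exp_add]; congr 1; ring
  have hexp2 : Real.exp (-(δ₁ / 2 * (geomT D).dist y y')) ≤
      Real.exp (-(δ₁ / 2 * ((R : ℝ) * (((ℓ : ℝ) + 1) * Mh) - 1) * ((lgap D.toDomains y y' - 1 : ℕ) : ℝ))) := by
    rw [Real.exp_le_exp, neg_le_neg_iff, mul_assoc]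
    exact mul_le_mul_of_nonneg_left hsep (by positivity)
  have habs := pow_absorb (Lp := ((ℓ : ℝ) + 1) ^ (d + 3)) (β := δ₁ / 2)
    (N := (R : ℝ) * (((ℓ : ℝ) + 1) * Mh) - 1) (one_le_pow₀ hL1) hsmall1 (lgap D.toDomains y y')
  have hE0 : 0 ≤ Real.exp (-(δ₁ / 2 * (geomT D).dist y y')) := (Real.exp_pos _).le
  have hP0 : 0 ≤ ((((nb D.toDomains y : ℕ) : ℝ) ^ 4)⁻¹ * (W D.toDomains y')⁻¹) := by
    have := nbR_pos D y; have := W_pos D.toDomains y'; positivity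
  have hγ : 0 ≤ 2 / (C4 d aplus)⁻¹ := by have := C4_pos d aplus; positivity
  calc cw D.toDomains y / W D.toDomains y * (cw D.toDomains y' / W D.toDomains y') * |(BmT D a)⁻¹ y y'|
      ≤ ((((ℓ : ℝ) + 1) ^ (d + 3)) ^ lgap D.toDomains y y' * ((((nb D.toDomains y : ℕ) : ℝ) ^ 4)⁻¹ * (W D.toDomains y')⁻¹)) *
          (2 / (C4 d aplus)⁻¹ * Real.exp (-(δ₁ * (geomT D).dist y y'))) :=
        mul_le_mul hwt hinv (abs_nonneg _) (by positivity)
    _ = 2 / (C4 d aplus)⁻¹ * ((((nb D.toDomains y : ℕ) : ℝ) ^ 4)⁻¹ * (W D.toDomains y')⁻¹) *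
          ((((ℓ : ℝ) + 1) ^ (d + 3)) ^ lgap D.toDomains y y' * Real.exp (-(δ₁ / 2 * (geomT D).dist y y'))) *
          Real.exp (-(δ₁ / 2 * (geomT D).dist y y')) := by rw [hsplit]; ring
    _ ≤ 2 / (C4 d aplus)⁻¹ * ((((nb D.toDomains y : ℕ) : ℝ) ^ 4)⁻¹ * (W D.toDomains y')⁻¹) *
          ((((ℓ : ℝ) + 1) ^ (d + 3)) ^ lgap D.toDomains y y' *
            Real.exp (-(δ₁ / 2 * ((R : ℝ) * (((ℓ : ℝ) + 1) * Mh) - 1) * ((lgap D.toDomains y y' - 1 : ℕ) : ℝ)))) *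
          Real.exp (-(δ₁ / 2 * (geomT D).dist y y')) := by
        apply mul_le_mul_of_nonneg_right _ hE0
        exact mul_le_mul_of_nonneg_left (mul_le_mul_of_nonneg_left hexp2 (by positivity)) (mul_nonneg hγ hP0)
    _ ≤ 2 / (C4 d aplus)⁻¹ * ((((nb D.toDomains y : ℕ) : ℝ) ^ 4)⁻¹ * (W D.toDomains y')⁻¹) *
          ((ℓ : ℝ) + 1) ^ (d + 3) * Real.exp (-(δ₁ / 2 * (geomT D).dist y y')) := by
        apply mul_le_mul_of_nonneg_right _ hE0
        exact mul_le_mul_of_nonneg_left habs (mul_nonneg hγ hP0)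
    _ = _ := by ring

end Inverse

/-! ## §5 Proposition 2.3 (2.87) for the genuine `k`-level operator on the torus, thresholds explicit -/

section Package

/-- **[B6] PROPOSITION 2.3, THE ESTIMATE (2.87), FOR THE GENUINE `k`-LEVEL OPERATOR ON THE TORUS `T_η`.**  There are
`δ₁, C, M₀ > 0` (functions of `d`, `L` and the weight window) such that for every number of levels `k`, every `M_h` with
`L·M_h ≥ M₀` («for M large enough»), every `R ≥ 2L`, all periods `P_μ ≥ 4`, every nested family `D` of domains of the
torus ((2.1)–(2.2), `Ω₁ = T_η`) and all windowed weights, with `X = XkT` the (2.69)-kernel of `Q′G′²Q′*`, `G′ = Δ′_a⁻¹`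
genuine: the operator `K_W(X) = Q′G′²Q′*` on `ℝ^𝔅` has the two-sided inverse `GinvT` («(Q′G′²Q′*)⁻¹»), UNIQUE, and its
(2.69)-kernel obeys **(2.87)** `|(Q′G′²Q′*)⁻¹(y, y′)| ≤ C(L^j)^{−4}(L^{j′})^{−(d+1)}e^{−½δ₁d_T(y,y′)}` with `d_T` print's
distance (2.46) on the torus.  Route: (2.68)_T (`ineq268_multiLevelTorus`) + the GLOBAL (2.78)_T
(`qggq_coercive_multiLevelTorus`) ⇒ [3] (5.6) for the conjugated kernel on ALL of `𝔅` ⇒ (5.7) (`B4Sect5Torus.inv_decay`,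
profile = Lemma 2.1 on the torus at `α = 1/16`) ⇒ (2.80)-type unconjugation with the level ratios absorbed by (2.60).
[cite: Balaban1984PropagatorsII, Prop. 2.3 (2.87) p.238, (2.79)–(2.81) p.237, p.224 (Ω_j = T_η admitted); Balaban1983RegularityDecay, Sect. 5 (5.6)–(5.7) p.594] -/
theorem prop23_multiLevelTorus (d ℓ : ℕ) (hℓ : 1 ≤ ℓ) (aminus aplus a2minus a2plus : ℝ) (ha : 0 < aminus)
    (ha2 : 0 < a2minus) :
    ∃ δ₁ C M₀ : ℝ, 0 < δ₁ ∧ 0 < C ∧ 0 < M₀ ∧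
      ∀ (k Mh R : ℕ), M₀ ≤ ((ℓ : ℝ) + 1) * Mh → 2 * (ℓ + 1) ≤ R →
      ∀ (P : Fin (d + 1) → ℕ) (_hP : ∀ μ, 1 ≤ P μ) (_hP4 : ∀ μ, 4 ≤ P μ) (D : TDomains d ℓ Mh k P R) (a c : ℕ → ℝ),
        (∀ i, aminus ≤ a i ∧ a i ≤ aplus) → (∀ i, a2minus ≤ c i ∧ c i ≤ a2plus) →
        (∀ i, a (i + 1) = aNext ℓ (a i) (c i)) →
        GinvT D a * kerOp (W D.toDomains) (XkT D a) = 1 ∧ kerOp (W D.toDomains) (XkT D a) * GinvT D a = 1 ∧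
        (∀ G' : Module.End ℝ (↥(bset D.toDomains) → ℝ), G' * kerOp (W D.toDomains) (XkT D a) = 1 → G' = GinvT D a) ∧
        ∀ y y' : ↥(bset D.toDomains), |mat (GinvT D a) y y' / W D.toDomains y'| ≤
          C * (geomT D).len y ^ (-(4 : ℝ)) * (geomT D).len y' ^ (-((d + 1 : ℕ) : ℝ)) *
            Real.exp (-(δ₁ / 2 * (geomT D).dist y y')) := by
  obtain ⟨δ₀, CX, M₀, N₀, hδ₀, hCX, hM₀, hN₀, h268⟩ :=
    ineq268_multiLevelTorus d ℓ hℓ aminus aplus a2minus a2plus ha ha2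
  have hL0 : (0 : ℝ) < (ℓ : ℝ) + 1 := by positivity
  have hL1 : (1 : ℝ) ≤ (ℓ : ℝ) + 1 := by linarith [(Nat.cast_nonneg ℓ : (0 : ℝ) ≤ ℓ)]
  have hlog : Real.log ((ℓ : ℝ) + 1) ≤ (ℓ : ℝ) + 1 := (Real.log_le_sub_one_of_pos hL0).trans (by linarith)
  have hlog0 : 0 ≤ Real.log ((ℓ : ℝ) + 1) := Real.log_nonneg hL1
  -- a positive upper weight (the window may be empty): `A = max a₊ a₋`
  obtain ⟨A, hAdef⟩ : ∃ A : ℝ, A = max aplus aminus := ⟨_, rfl⟩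
  have hA0 : 0 < A := by rw [hAdef]; exact lt_of_lt_of_le ha (le_max_right _ _)
  -- the (2.59)-type threshold for Lemma 2.1 on the torus at `α = 1/16`
  obtain ⟨N₁, hN₁⟩ : ∃ N₁ : ℕ, N₁ = ⌈64 * ((d : ℝ) + 1) * ((ℓ : ℝ) + 1) / δ₀⌉₊ + 1 := ⟨_, rfl⟩
  have hN₁pos : 0 < N₁ := by rw [hN₁]; omega
  have hN₁ge : 64 * ((d : ℝ) + 1) * ((ℓ : ℝ) + 1) < δ₀ * (N₁ : ℝ) := by
    have h : 64 * ((d : ℝ) + 1) * ((ℓ : ℝ) + 1) / δ₀ < (N₁ : ℝ) := by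
      rw [hN₁]; push_cast; exact lt_of_le_of_lt (Nat.le_ceil _) (by linarith)
    rw [div_lt_iff₀ hδ₀] at h; linarith
  have hθ16 : Real.exp (-(1 / 16 * δ₀)) * ((ℓ : ℝ) + 1) ^ ((2 * (d + 1 : ℕ) : ℝ) / N₁) < 1 := by
    refine theta_lt_one_of_log hL0 hN₁pos ?_
    push_cast
    have hd0 : (0 : ℝ) ≤ 2 * ((d : ℝ) + 1) := by positivity
    nlinarith [mul_le_mul_of_nonneg_left hlog hd0]
  -- constants
  obtain ⟨cK, hcK⟩ : ∃ cK : ℝ, cK = K261 N₁ (d + 1) ((ℓ : ℝ) + 1) 1 (1 / 16 * δ₀) := ⟨_, rfl⟩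
  have hcK0 : 0 ≤ cK := by rw [hcK]; exact K261_nonneg (by positivity) zero_le_one
  obtain ⟨δ₁, hδ₁⟩ : ∃ δ₁ : ℝ, δ₁ = rate (fun _ => cK) (C4 d A)⁻¹ (CX * ((ℓ : ℝ) + 1) ^ (d + 3)) (δ₀ / 8) := ⟨_, rfl⟩
  have hδ₁0 : 0 < δ₁ := by
    rw [hδ₁]
    exact rate_pos (K := fun _ => cK) (fun _ _ => hcK0) (inv_pos.2 (C4_pos d A)) (by positivity) (by positivity)
  -- the absorption thresholds `L^{d+3} ≤ e^{(δ₀/8)(RM − 1)}` and `L^{d+3} ≤ e^{(δ₁/2)(RM − 1)}`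
  obtain ⟨N₂, hN₂⟩ : ∃ N₂ : ℕ, N₂ = ⌈8 * ((d : ℝ) + 3) * ((ℓ : ℝ) + 1) / δ₀⌉₊ := ⟨_, rfl⟩
  have hN₂ge : 8 * ((d : ℝ) + 3) * ((ℓ : ℝ) + 1) ≤ δ₀ * (N₂ : ℝ) := by
    have h : 8 * ((d : ℝ) + 3) * ((ℓ : ℝ) + 1) / δ₀ ≤ (N₂ : ℝ) := by rw [hN₂]; exact Nat.le_ceil _
    rw [div_le_iff₀ hδ₀] at h; linarith
  obtain ⟨N₃, hN₃⟩ : ∃ N₃ : ℕ, N₃ = ⌈2 * ((d : ℝ) + 3) * ((ℓ : ℝ) + 1) / δ₁⌉₊ := ⟨_, rfl⟩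
  have hN₃ge : 2 * ((d : ℝ) + 3) * ((ℓ : ℝ) + 1) ≤ δ₁ * (N₃ : ℝ) := by
    have h : 2 * ((d : ℝ) + 3) * ((ℓ : ℝ) + 1) / δ₁ ≤ (N₃ : ℝ) := by rw [hN₃]; exact Nat.le_ceil _
    rw [div_le_iff₀ hδ₁0] at h; linarith
  obtain ⟨Nmax, hNmax⟩ : ∃ Nmax : ℕ, Nmax = max N₀ (max N₁ (max N₂ N₃)) := ⟨_, rfl⟩
  have hN0le : N₀ ≤ Nmax := by rw [hNmax]; exact le_max_left _ _
  have hN1le : N₁ ≤ Nmax := by rw [hNmax]; exact (le_max_left _ _).trans (le_max_right _ _)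
  have hN2le : N₂ ≤ Nmax := by
    rw [hNmax]; exact ((le_max_left _ _).trans (le_max_right _ _)).trans (le_max_right _ _)
  have hN3le : N₃ ≤ Nmax := by
    rw [hNmax]; exact ((le_max_right _ _).trans (le_max_right _ _)).trans (le_max_right _ _)
  obtain ⟨M₁, hM₁⟩ : ∃ M₁ : ℝ, M₁ = max (3 * ((ℓ : ℝ) + 1)) (max M₀ ((Nmax : ℝ) + 1)) := ⟨_, rfl⟩
  have h3le : 3 * ((ℓ : ℝ) + 1) ≤ M₁ := by rw [hM₁]; exact le_max_left _ _
  have hM0le : M₀ ≤ M₁ := by rw [hM₁]; exact (le_max_left _ _).trans (le_max_right _ _)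
  have hNmaxle : (Nmax : ℝ) + 1 ≤ M₁ := by rw [hM₁]; exact (le_max_right _ _).trans (le_max_right _ _)
  have hM₁pos : 0 < M₁ := lt_of_lt_of_le (by positivity) h3le
  obtain ⟨C, hC⟩ : ∃ C : ℝ, C = 2 / (C4 d A)⁻¹ * ((ℓ : ℝ) + 1) ^ (d + 3) := ⟨_, rfl⟩
  have hCpos : 0 < C := by rw [hC]; have := C4_pos d A; positivity
  refine ⟨δ₁, C, M₁, hδ₁0, hCpos, hM₁pos, ?_⟩
  intro k Mh R hM hR P hP hP4 D a c haw hcw hac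
  -- the member's thresholds
  have hMh3 : 3 ≤ Mh := by
    have : (3 : ℝ) ≤ Mh := by nlinarith [h3le.trans hM]
    exact_mod_cast this
  have hMh1 : 1 ≤ Mh := le_trans (by norm_num) hMh3
  have hM0 : M₀ ≤ ((ℓ : ℝ) + 1) * Mh := hM0le.trans hM
  have hR1 : 1 ≤ R := le_trans (by omega) hR
  have hRMmax : Nmax + 1 ≤ R * ((ℓ + 1) * Mh) := by
    have h1 : ((Nmax + 1 : ℕ) : ℝ) ≤ (((ℓ + 1) * Mh : ℕ) : ℝ) := by push_cast; exact hNmaxle.trans hM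
    have h2 : Nmax + 1 ≤ (ℓ + 1) * Mh := by exact_mod_cast h1
    exact h2.trans (Nat.le_mul_of_pos_left _ hR1)
  have hRM0 : N₀ + 1 ≤ R * ((ℓ + 1) * Mh) := le_trans (Nat.succ_le_succ hN0le) hRMmax
  have hRM1 : N₁ + 1 ≤ R * ((ℓ + 1) * Mh) := le_trans (Nat.succ_le_succ hN1le) hRMmax
  have hRM2 : N₂ + 1 ≤ R * ((ℓ + 1) * Mh) := le_trans (Nat.succ_le_succ hN2le) hRMmax
  have hRM3 : N₃ + 1 ≤ R * ((ℓ + 1) * Mh) := le_trans (Nat.succ_le_succ hN3le) hRMmax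
  have hRMone : 1 ≤ R * ((ℓ + 1) * Mh) := le_trans (by omega) hRM1
  have ha' : ∀ j, 0 < a j := fun j => lt_of_lt_of_le ha (haw j).1
  have hale : ∀ j, a j ≤ A := fun j => (haw j).2.trans (by rw [hAdef]; exact le_max_left _ _)
  -- (2.68)_T, Lemma 2.1 on the torus at `1/16`, the absorption thresholds
  have hX : ∀ y y', |XkT D a y y'| ≤ CX * (geomT D).len y ^ 4 * ((geomT D).len y' ^ (d + 1))⁻¹ *
      Real.exp (-(δ₀ / 4 * (geomT D).dist y y')) :=
    fun y y' => (h268 k Mh R hMh3 hM0 hR hRM0 P hP hP4 D a c haw hcw hac y y').1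
  obtain ⟨-, h261, -, -⟩ := lemma21_torus D hMh1 hP hN₁pos hRM1 hδ₀.le (α := 1 / 16) (by norm_num) (by norm_num) hθ16
  have h261' : Ineq261With cK (geomT D) δ₀ (1 / 16) := by rw [hcK]; exact fun z => h261 z
  have hRMge : ∀ {N : ℕ}, N + 1 ≤ R * ((ℓ + 1) * Mh) → (N : ℝ) ≤ (R : ℝ) * (((ℓ : ℝ) + 1) * Mh) - 1 := by
    intro N hN
    have : ((N + 1 : ℕ) : ℝ) ≤ ((R * ((ℓ + 1) * Mh) : ℕ) : ℝ) := by exact_mod_cast hN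
    push_cast at this; linarith
  have hpowexp : ((ℓ : ℝ) + 1) ^ (d + 3) = Real.exp (((d : ℝ) + 3) * Real.log ((ℓ : ℝ) + 1)) := by
    rw [← Real.exp_log (pow_pos hL0 (d + 3)), Real.log_pow]; push_cast; ring_nf
  have hsmall : ((ℓ : ℝ) + 1) ^ (d + 3) * Real.exp (-(δ₀ / 8 * ((R : ℝ) * (((ℓ : ℝ) + 1) * Mh) - 1))) ≤ 1 := by
    have hge := hRMge hRM2
    have hd3 : (0 : ℝ) ≤ (d : ℝ) + 3 := by positivity
    have e1 : ((d : ℝ) + 3) * Real.log ((ℓ : ℝ) + 1) ≤ ((d : ℝ) + 3) * ((ℓ : ℝ) + 1) :=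
      mul_le_mul_of_nonneg_left hlog hd3
    have e2 : δ₀ * (N₂ : ℝ) ≤ δ₀ * ((R : ℝ) * (((ℓ : ℝ) + 1) * Mh) - 1) := mul_le_mul_of_nonneg_left hge hδ₀.le
    have h1 : ((d : ℝ) + 3) * Real.log ((ℓ : ℝ) + 1) ≤ δ₀ / 8 * ((R : ℝ) * (((ℓ : ℝ) + 1) * Mh) - 1) := by
      linarith
    rw [hpowexp, ← Real.exp_add, Real.exp_le_one_iff]
    linarith
  have hsmall1 : ((ℓ : ℝ) + 1) ^ (d + 3) * Real.exp (-(rate (fun _ => cK) (C4 d A)⁻¹ (CX * ((ℓ : ℝ) + 1) ^ (d + 3))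
      (δ₀ / 8) / 2 * ((R : ℝ) * (((ℓ : ℝ) + 1) * Mh) - 1))) ≤ 1 := by
    rw [← hδ₁]
    have hge := hRMge hRM3
    have hd3 : (0 : ℝ) ≤ (d : ℝ) + 3 := by positivity
    have e1 : ((d : ℝ) + 3) * Real.log ((ℓ : ℝ) + 1) ≤ ((d : ℝ) + 3) * ((ℓ : ℝ) + 1) :=
      mul_le_mul_of_nonneg_left hlog hd3
    have e2 : δ₁ * (N₃ : ℝ) ≤ δ₁ * ((R : ℝ) * (((ℓ : ℝ) + 1) * Mh) - 1) := mul_le_mul_of_nonneg_left hge hδ₁0.le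
    have h1 : ((d : ℝ) + 3) * Real.log ((ℓ : ℝ) + 1) ≤ δ₁ / 2 * ((R : ℝ) * (((ℓ : ℝ) + 1) * Mh) - 1) := by
      linarith
    rw [hpowexp, ← Real.exp_add, Real.exp_le_one_iff]
    linarith
  have hU := isUnit_BmT D a hℓ hMh1 hP ha' hale
  refine ⟨GinvT_mul_X D a hU, X_mul_GinvT D a hU, GinvT_unique D a hU, fun y y' => ?_⟩
  have h := CinvT_decay D a hℓ hMh1 hP hRMone ha' hale hCX.le hδ₀ hcK0 hX hsmall h261' hsmall1 y y'
  rw [← hδ₁] at h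
  rw [mat_GinvT_div]
  have hly := lenT_pos D y
  have hly' := lenT_pos D y'
  rw [Real.rpow_neg hly.le, Real.rpow_neg hly'.le, show (4 : ℝ) = ((4 : ℕ) : ℝ) by norm_num, Real.rpow_natCast,
    Real.rpow_natCast, hC]
  exact h

end Package

end

end Literature.MathematicalPhysics.QuantumFieldTheory.Balaban1983to89.B6Prop23MultiLevelTorusL0
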